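import Summits.Parity.GeneralizedHardyLittlewood.Theorems.BeyondDiagonalBeatsQuarter.MellinBumpBV
import HarnessLib

/-!
# Route `PrimeLevelFamEdge`, crux K_B (stmt-Parity-20343), line `diagonal_kernel_split` rev 4, plan Ω —
# **C1 for TWO GENERAL Möbius-type weights of DIFFERENT lengths** (input I5b of the a8P-closable total:
# the divisor layers `d₁, d₂ > 1` carry the weights `W·𝟙_{(·,d_i)=1}` and the lengths `M/d_i`)

`MellinBumpBV.mellinBump_xsq_bv` bounds `Σ_{m₁,m₂≤M} (x_{m₁}/m₁)(x_{m₂}/m₂)·h(m₁m₂/Y)` using only two facts about the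
weight `x_m/m = W(m)·λ_M(m)`: the envelope `λ_M` (`logWeight M`: in `[0,1]`, antitone) and the partial sums of `W`
beyond the threshold `√(aY) − 1` (`|Σ_{j≤e} W(j)| ≤ η`). In the divisor layers of the off-diagonal core the pair sum
runs over `l = d₁m₁`, `m = d₂m₂` with `c_{d m} ∝ 𝟙[(m,d)=1]·W(m)·λ_{M/d}(m)`: a DIFFERENT Möbius weight per variable and
two different lengths, and the `m₁ ↔ m₂` symmetry of the original proof is gone. This file re-runs the Abel argument
for general weights:

* §1 `abs_inner_le_bv_weight` — the inner Abel bound for any weight `w` with `|Σ_{j≤e} w j| ≤ η` beyond the threshold;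
* §2 `abs_mul_logWeight_le_inv`, the region lemmas, and **`mellinBump_weights_bv`** — for weights `w₁, w₂` with
  `|w_i(m)| ≤ 1/m` and `|Σ_{j≤e} w_i j| ≤ η` (`e ≥ √(aY) − 1`), lengths `M₁, M₂ > 1`, a `K`-Lipschitz window `h`
  supported in `[a,b]` (`a > 0`) with `|h| ≤ B`, and `Y ≥ 1`:
  `|Σ_{m₁≤M₁} Σ_{m₂≤M₂} w₁(m₁)λ_{M₁}(m₁)·w₂(m₂)λ_{M₂}(m₂)·h(m₁m₂/Y)|
     ≤ η·(2(2B + K(b−a))(1+|log b|)(1 + log Y) + 4K√(bY)/Y)`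
  (region `m₁ ≤ m₂`: Abel in `m₂`; region `m₂ < m₁`: Abel in `m₁`). With `w₁ = w₂ = W`, `M₁ = M₂` and
  `η = D/(1+log Y)^{k+1}` (`MellinBump.abs_sum_W_le_threshold`) this is `mellinBump_xsq_bv` again; with
  `w_i = W·𝟙_{(·,d_i)=1}` it is the divisor-layer C1 once the restricted partial sums are bounded (input I5a).

Theorems only; standard axioms. Helper toward `stub_offDiagBelowSlack_io`; closes nothing.
«The programme SEARCHES and TYPES; no claim about Landau–Siegel zeros, Theorems 1–2 of arXiv:2211.02515 or
a repaired Margin232 until a kernel theorem says so.»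
-/

noncomputable section

open scoped Real ArithmeticFunction.Moebius
open Finset ArithmeticFunction

namespace Summit.Parity.GeneralizedHardyLittlewood.Theorems.BeyondDiagonalBeatsQuarter.MellinBump

open Literature.NumberTheory.LFunctions Literature.NumberTheory.LFunctions.KMV2000
open MollifierMainTerm (W)
open KernelFormXSq

/-! ### §1. The inner Abel bound for a general weight -/

/-- **The inner sum after Abel summation, for a GENERAL weight `w`** (`MellinBumpBV.abs_inner_le_bv` with
`W ↦ w`: only the partial sums of `w` beyond the threshold `√(aY) − 1` enter):
`|Σ_{u < m₂ ≤ ⌊M⌋} w(m₂)·λ_M(m₂)·h(m₁m₂/Y)| ≤ η·(2B + K(b − a) + 2K·m₁/Y)`. [folklore] -/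
theorem abs_inner_le_bv_weight (w : ℕ → ℝ) {h : ℝ → ℝ} {a b K B : ℝ} (ha : 0 < a) (hab : a ≤ b) (hK : 0 ≤ K)
    (hLip : ∀ x y, |h x - h y| ≤ K * |x - y|) (hsupp : ∀ y, h y ≠ 0 → a ≤ y ∧ y ≤ b)
    (hBh : ∀ y, |h y| ≤ B)
    {M Y η : ℝ} (hM : 1 < M) (hY : 1 ≤ Y) (hη : 0 ≤ η)
    (hA : ∀ e : ℕ, Real.sqrt (a * Y) - 1 ≤ (e : ℝ) → |∑ j ∈ Icc 1 e, w j| ≤ η)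
    {m₁ u : ℕ} (hm₁ : 1 ≤ m₁) (hu : m₁ ≤ u + 1) (huN : u ≤ ⌊M⌋₊) :
    |∑ m₂ ∈ Ioc u ⌊M⌋₊, w m₂ * (logWeight M m₂ * h ((m₁ : ℝ) / Y * m₂))| ≤
      η * (2 * B + (K * (b - a) + 2 * K * ((m₁ : ℝ) / Y))) := by
  have hY0 : 0 < Y := by linarith
  have hm0 : (0 : ℝ) < m₁ := by exact_mod_cast hm₁
  have hc0 : 0 < (m₁ : ℝ) / Y := by positivity
  have hB0 : 0 ≤ B := (abs_nonneg _).trans (hBh 0)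
  -- where the weight moves, the partial sums are small
  have hmove : ∀ e, u ≤ e → e ≤ ⌊M⌋₊ →
      ((fun e : ℕ ↦ logWeight M e * h ((m₁ : ℝ) / Y * e)) e ≠ 0 ∨
        (fun e : ℕ ↦ logWeight M e * h ((m₁ : ℝ) / Y * e)) (e + 1) ≠ 0) →
      |∑ j ∈ Icc 1 e, (fun j : ℕ ↦ w j) j| ≤ η := by
    intro e hue _ hmv
    apply hA
    have hex : a * Y / m₁ ≤ (e : ℝ) + 1 := by
      rcases hmv with h1 | h1
      · have hh : h ((m₁ : ℝ) / Y * e) ≠ 0 := fun h0 ↦ h1 (by simp only [h0, mul_zero])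
        have h2 := (hsupp _ hh).1
        rw [show (m₁ : ℝ) / Y * e = (m₁ : ℝ) * e / Y by ring, le_div_iff₀ hY0] at h2
        rw [div_le_iff₀ hm0]
        nlinarith
      · have hh : h ((m₁ : ℝ) / Y * ((e + 1 : ℕ) : ℝ)) ≠ 0 := fun h0 ↦ h1 (by simp only [h0, mul_zero])
        have h2 := (hsupp _ hh).1
        push_cast at h2
        rw [show (m₁ : ℝ) / Y * ((e : ℝ) + 1) = (m₁ : ℝ) * ((e : ℝ) + 1) / Y by ring,
          le_div_iff₀ hY0] at h2
        rw [div_le_iff₀ hm0]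
        linarith
    have hm : (m₁ : ℝ) ≤ (e : ℝ) + 1 := by exact_mod_cast (by omega : m₁ ≤ e + 1)
    have hprod : a * Y ≤ ((e : ℝ) + 1) ^ 2 := by
      have e1 : (m₁ : ℝ) * (a * Y / m₁) = a * Y := by field_simp
      calc a * Y = (m₁ : ℝ) * (a * Y / m₁) := e1.symm
        _ ≤ ((e : ℝ) + 1) * ((e : ℝ) + 1) := mul_le_mul hm hex (by positivity) (by positivity)
        _ = ((e : ℝ) + 1) ^ 2 := by ring
    have : Real.sqrt (a * Y) ≤ (e : ℝ) + 1 := by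
      rw [← Real.sqrt_sq (by positivity : (0 : ℝ) ≤ (e : ℝ) + 1)]
      exact Real.sqrt_le_sqrt hprod
    linarith
  have hφN : (fun e : ℕ ↦ logWeight M e * h ((m₁ : ℝ) / Y * e)) (⌊M⌋₊ + 1) = 0 := by
    simp only [logWeight_of_lt (Nat.lt_succ_self _), zero_mul]
  have habel := abs_sum_mul_le_of_tv (fun j : ℕ ↦ w j)
    (fun e : ℕ ↦ logWeight M e * h ((m₁ : ℝ) / Y * e)) huN hmove hφN
  -- total variation of the weight
  have hTVl : ∑ e ∈ Ioc u ⌊M⌋₊, |logWeight M e - logWeight M (e + 1)| ≤ logWeight M (u + 1) :=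
    tv_antitone_le _ huN (logWeight_nonneg M) (fun e hue ↦ logWeight_succ_le hM (by omega))
  have hTVg : ∑ e ∈ Ioc u ⌊M⌋₊, |h ((m₁ : ℝ) / Y * e) - h ((m₁ : ℝ) / Y * (e + 1))| ≤
      K * (b - a) + 2 * K * ((m₁ : ℝ) / Y) := tv_comp_mul_le ha hab hK hc0 hLip hsupp _
  have h1 := tv_mul_le (logWeight M) (fun e : ℕ ↦ h ((m₁ : ℝ) / Y * e)) (Ioc u ⌊M⌋₊)
    (abs_logWeight_le_one hM) (fun n ↦ hBh _)
  push_cast at h1 habel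
  have hlu : logWeight M (u + 1) ≤ 1 := logWeight_le_one hM (by omega)
  have hφu : |logWeight M (u + 1) * h ((m₁ : ℝ) / Y * ((u : ℝ) + 1))| ≤ B := by
    rw [abs_mul]
    calc |logWeight M (u + 1)| * |h ((m₁ : ℝ) / Y * ((u : ℝ) + 1))| ≤ 1 * B :=
          mul_le_mul (abs_logWeight_le_one hM _) (hBh _) (abs_nonneg _) zero_le_one
      _ = B := one_mul _
  have hTV : ∑ e ∈ Ioc u ⌊M⌋₊, |logWeight M e * h ((m₁ : ℝ) / Y * e) -
      logWeight M (e + 1) * h ((m₁ : ℝ) / Y * ((e : ℝ) + 1))| ≤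
      B + (K * (b - a) + 2 * K * ((m₁ : ℝ) / Y)) := by
    refine h1.trans ?_
    have hA' : B * ∑ e ∈ Ioc u ⌊M⌋₊, |logWeight M e - logWeight M (e + 1)| ≤ B * 1 :=
      mul_le_mul_of_nonneg_left (hTVl.trans hlu) hB0
    linarith
  calc |∑ m₂ ∈ Ioc u ⌊M⌋₊, w m₂ * (logWeight M m₂ * h ((m₁ : ℝ) / Y * m₂))|
      ≤ η * (∑ e ∈ Ioc u ⌊M⌋₊, |logWeight M e * h ((m₁ : ℝ) / Y * e) -
          logWeight M (e + 1) * h ((m₁ : ℝ) / Y * ((e : ℝ) + 1))| +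
          |logWeight M (u + 1) * h ((m₁ : ℝ) / Y * ((u : ℝ) + 1))|) := habel
    _ ≤ η * (B + (K * (b - a) + 2 * K * ((m₁ : ℝ) / Y)) + B) := by gcongr
    _ = η * (2 * B + (K * (b - a) + 2 * K * ((m₁ : ℝ) / Y))) := by ring


/-! ### §2. Two weights, two lengths -/

/-- The product weight is at most `1/m` in absolute value: `|w(m)·λ_M(m)| ≤ 1/m` if `|w(m)| ≤ 1/m`, `M > 1`, `m ≥ 1`.
[folklore] -/
theorem abs_mul_logWeight_le_inv {w : ℕ → ℝ} (hw : ∀ m : ℕ, 1 ≤ m → |w m| ≤ (m : ℝ)⁻¹) {M : ℝ} (hM : 1 < M)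
    {m : ℕ} (hm : 1 ≤ m) : |w m * logWeight M m| ≤ (m : ℝ)⁻¹ := by
  rw [abs_mul]
  calc |w m| * |logWeight M m| ≤ (m : ℝ)⁻¹ * 1 :=
        mul_le_mul (hw m hm) (abs_logWeight_le_one hM m) (abs_nonneg _) (by positivity)
    _ = (m : ℝ)⁻¹ := mul_one _

/-- **One region of the two-weight sum.** Outer variable `n ≤ N` with weight `v` (`|v(n)| ≤ 1/n`), inner variable
over `(u(n), ⌊M⌋]` with `n ≤ u(n) + 1`, weight `w·λ_M` and the Abel bound of §1: the region total is at most
`η·((2B + K(b−a))(1+|log b|)(1+log Y) + 2K√(bY)/Y)`. [folklore] -/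
theorem abs_sum_region_le {v w : ℕ → ℝ} (hv : ∀ n : ℕ, 1 ≤ n → |v n| ≤ (n : ℝ)⁻¹)
    {h : ℝ → ℝ} {a b K B : ℝ} (ha : 0 < a) (hab : a ≤ b) (hK : 0 ≤ K)
    (hLip : ∀ x y, |h x - h y| ≤ K * |x - y|) (hsupp : ∀ y, h y ≠ 0 → a ≤ y ∧ y ≤ b)
    (hBh : ∀ y, |h y| ≤ B) {M Y η : ℝ} (hM : 1 < M) (hY : 1 ≤ Y) (hη : 0 ≤ η)
    (hA : ∀ e : ℕ, Real.sqrt (a * Y) - 1 ≤ (e : ℝ) → |∑ j ∈ Icc 1 e, w j| ≤ η)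
    (N : ℕ) (u : ℕ → ℕ) (hu : ∀ n, 1 ≤ n → n ≤ u n + 1) (hu' : ∀ n, 1 ≤ n → n - 1 ≤ u n) :
    |∑ n ∈ Icc 1 N, v n * ∑ m ∈ Ioc (u n) ⌊M⌋₊, w m * (logWeight M m * h ((n : ℝ) / Y * m))| ≤
      η * ((2 * B + K * (b - a)) * (1 + |Real.log b|) * (1 + Real.log Y) +
        2 * K * (Real.sqrt (b * Y) / Y)) := by
  have hY0 : 0 < Y := by linarith
  have hb : 0 < b := by linarith
  have hB0 : 0 ≤ B := (abs_nonneg _).trans (hBh 0)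
  have hX : 0 < Real.sqrt (b * Y) := Real.sqrt_pos.2 (by positivity)
  have hLY : 0 ≤ Real.log Y := Real.log_nonneg hY
  set L : ℝ := 1 + Real.log Y with hL
  set c₁ : ℝ := η * (2 * B + K * (b - a)) with hc₁
  set c₂ : ℝ := 2 * η * K / Y with hc₂
  have hKba : 0 ≤ K * (b - a) := mul_nonneg hK (by linarith)
  have hc₁0 : 0 ≤ c₁ := by positivity
  have hc₂0 : 0 ≤ c₂ := by positivity
  -- per outer index
  have hper : ∀ n ∈ Icc 1 N,
      |v n * ∑ m ∈ Ioc (u n) ⌊M⌋₊, w m * (logWeight M m * h ((n : ℝ) / Y * m))| ≤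
      (if (n : ℝ) ≤ Real.sqrt (b * Y) then (n : ℝ)⁻¹ else 0) * c₁ +
        (if (n : ℝ) ≤ Real.sqrt (b * Y) then (1 : ℝ) else 0) * c₂ := by
    intro n hn
    have hn' := Finset.mem_Icc.1 hn
    have hn0 : (0 : ℝ) < n := by exact_mod_cast hn'.1
    rw [abs_mul]
    split_ifs with hP
    · by_cases huN : u n ≤ ⌊M⌋₊
      · have hI := abs_inner_le_bv_weight w ha hab hK hLip hsupp hBh hM hY hη hA hn'.1 (hu n hn'.1) huN
        calc |v n| * |∑ m ∈ Ioc (u n) ⌊M⌋₊, w m * (logWeight M m * h ((n : ℝ) / Y * m))|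
            ≤ (n : ℝ)⁻¹ * (η * (2 * B + (K * (b - a) + 2 * K * ((n : ℝ) / Y)))) :=
              mul_le_mul (hv n hn'.1) hI (abs_nonneg _) (by positivity)
          _ = (n : ℝ)⁻¹ * c₁ + 1 * c₂ := by rw [hc₁, hc₂]; field_simp; ring
      · -- empty inner range
        have hempty : Ioc (u n) ⌊M⌋₊ = ∅ := Finset.Ioc_eq_empty (by omega)
        rw [hempty, Finset.sum_empty, abs_zero, mul_zero]
        positivity
    · -- n > √(bY): every term vanishes (m ≥ n forces n·m > bY)
      push Not at hP
      have hbY : b * Y < (n : ℝ) ^ 2 := by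
        have h1 : Real.sqrt (b * Y) ^ 2 = b * Y := Real.sq_sqrt (by positivity)
        nlinarith [Real.sqrt_nonneg (b * Y)]
      have hzero : ∑ m ∈ Ioc (u n) ⌊M⌋₊, w m * (logWeight M m * h ((n : ℝ) / Y * m)) = 0 := by
        refine Finset.sum_eq_zero fun m hm ↦ ?_
        rw [Finset.mem_Ioc] at hm
        have hm' : (n : ℝ) ≤ m := by
          have := hu' n hn'.1
          exact_mod_cast (by omega : n ≤ m)
        have hh : h ((n : ℝ) / Y * m) = 0 := by
          by_contra hne
          have := (hsupp _ hne).2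
          rw [div_mul_eq_mul_div, div_le_iff₀ hY0] at this
          nlinarith
        rw [hh, mul_zero, mul_zero]
      rw [hzero, abs_zero, mul_zero, zero_mul, zero_mul, add_zero]
  have hsum_inv : ∑ n ∈ Icc 1 N, (if (n : ℝ) ≤ Real.sqrt (b * Y) then (n : ℝ)⁻¹ else 0) ≤
      (1 + |Real.log b|) * L := by
    rw [← Finset.sum_filter]
    refine (sum_inv_filter_le hX N).trans ?_
    have h1 : Real.log (Real.sqrt (b * Y)) = (Real.log b + Real.log Y) / 2 := by
      rw [Real.log_sqrt (by positivity), Real.log_mul hb.ne' hY0.ne']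
    rw [h1, hL]
    have h2 : |(Real.log b + Real.log Y) / 2| ≤ (|Real.log b| + Real.log Y) / 2 := by
      rw [abs_div, abs_of_pos (by norm_num : (0 : ℝ) < 2)]
      gcongr
      exact (abs_add_le _ _).trans (by rw [abs_of_nonneg hLY])
    nlinarith [abs_nonneg (Real.log b)]
  have hsum_one : ∑ n ∈ Icc 1 N, (if (n : ℝ) ≤ Real.sqrt (b * Y) then (1 : ℝ) else 0) ≤
      Real.sqrt (b * Y) := sum_indicator_le_self hX N
  calc |∑ n ∈ Icc 1 N, v n * ∑ m ∈ Ioc (u n) ⌊M⌋₊, w m * (logWeight M m * h ((n : ℝ) / Y * m))|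
      ≤ ∑ n ∈ Icc 1 N, |v n * ∑ m ∈ Ioc (u n) ⌊M⌋₊, w m * (logWeight M m * h ((n : ℝ) / Y * m))| :=
        Finset.abs_sum_le_sum_abs _ _
    _ ≤ ∑ n ∈ Icc 1 N, ((if (n : ℝ) ≤ Real.sqrt (b * Y) then (n : ℝ)⁻¹ else 0) * c₁ +
          (if (n : ℝ) ≤ Real.sqrt (b * Y) then (1 : ℝ) else 0) * c₂) := Finset.sum_le_sum hper
    _ = (∑ n ∈ Icc 1 N, (if (n : ℝ) ≤ Real.sqrt (b * Y) then (n : ℝ)⁻¹ else 0)) * c₁ +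
          (∑ n ∈ Icc 1 N, (if (n : ℝ) ≤ Real.sqrt (b * Y) then (1 : ℝ) else 0)) * c₂ := by
        rw [Finset.sum_add_distrib, Finset.sum_mul, Finset.sum_mul]
    _ ≤ (1 + |Real.log b|) * L * c₁ + Real.sqrt (b * Y) * c₂ := by gcongr
    _ = η * ((2 * B + K * (b - a)) * (1 + |Real.log b|) * (1 + Real.log Y) +
          2 * K * (Real.sqrt (b * Y) / Y)) := by
        rw [hc₁, hc₂, hL]
        field_simp

/-- **C1 for two general weights of different lengths.** For weights `w₁, w₂ : ℕ → ℝ` with `|w_i(m)| ≤ 1/m` and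
partial sums `|Σ_{j≤e} w_i(j)| ≤ η` for `e ≥ √(aY) − 1`, lengths `M₁, M₂ > 1`, a `K`-Lipschitz window `h` supported
in `[a,b]` (`0 < a ≤ b`) with `|h| ≤ B`, and `Y ≥ 1`:
`|Σ_{m₁≤M₁} Σ_{m₂≤M₂} w₁(m₁)λ_{M₁}(m₁)·w₂(m₂)λ_{M₂}(m₂)·h(m₁m₂/Y)| ≤ η·(2(2B + K(b−a))(1+|log b|)(1+log Y) + 4K√(bY)/Y)`
(`λ_M = logWeight M`; region `m₁ ≤ m₂` by Abel in `m₂` with `w₂`, region `m₂ < m₁` by Abel in `m₁` with `w₁`).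
[cite: KowalskiMichelVanderKam2000, Prop. 5.1 p. 18 — derivation; MontgomeryVaughan2007, §8.1 (8.6)] -/
theorem mellinBump_weights_bv {w₁ w₂ : ℕ → ℝ} (hw₁ : ∀ m : ℕ, 1 ≤ m → |w₁ m| ≤ (m : ℝ)⁻¹)
    (hw₂ : ∀ m : ℕ, 1 ≤ m → |w₂ m| ≤ (m : ℝ)⁻¹)
    {h : ℝ → ℝ} {a b K B : ℝ} (ha : 0 < a) (hab : a ≤ b) (hK : 0 ≤ K)
    (hLip : ∀ x y, |h x - h y| ≤ K * |x - y|) (hsupp : ∀ y, h y ≠ 0 → a ≤ y ∧ y ≤ b)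
    (hBh : ∀ y, |h y| ≤ B) {M₁ M₂ Y η : ℝ} (hM₁ : 1 < M₁) (hM₂ : 1 < M₂) (hY : 1 ≤ Y) (hη : 0 ≤ η)
    (hA₁ : ∀ e : ℕ, Real.sqrt (a * Y) - 1 ≤ (e : ℝ) → |∑ j ∈ Icc 1 e, w₁ j| ≤ η)
    (hA₂ : ∀ e : ℕ, Real.sqrt (a * Y) - 1 ≤ (e : ℝ) → |∑ j ∈ Icc 1 e, w₂ j| ≤ η) :
    |∑ m₁ ∈ Icc 1 ⌊M₁⌋₊, ∑ m₂ ∈ Icc 1 ⌊M₂⌋₊,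
        (w₁ m₁ * logWeight M₁ m₁) * (w₂ m₂ * logWeight M₂ m₂) * h ((m₁ : ℝ) * m₂ / Y)| ≤
      η * (2 * ((2 * B + K * (b - a)) * (1 + |Real.log b|) * (1 + Real.log Y)) +
        4 * K * (Real.sqrt (b * Y) / Y)) := by
  set N₁ := ⌊M₁⌋₊ with hN₁
  set N₂ := ⌊M₂⌋₊ with hN₂
  set F : ℕ → ℕ → ℝ := fun m₁ m₂ ↦
    (w₁ m₁ * logWeight M₁ m₁) * (w₂ m₂ * logWeight M₂ m₂) * h ((m₁ : ℝ) * m₂ / Y) with hF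
  -- split the rectangle into `m₁ ≤ m₂` and `m₂ < m₁`
  have hsplit : ∑ m₁ ∈ Icc 1 N₁, ∑ m₂ ∈ Icc 1 N₂, F m₁ m₂ =
      ∑ m₁ ∈ Icc 1 N₁, ∑ m₂ ∈ (Icc 1 N₂).filter (fun m₂ : ℕ ↦ m₁ ≤ m₂), F m₁ m₂ +
        ∑ m₂ ∈ Icc 1 N₂, ∑ m₁ ∈ (Icc 1 N₁).filter (fun m₁ : ℕ ↦ m₂ < m₁), F m₁ m₂ := by
    have h1 : ∀ m₁ ∈ Icc 1 N₁, ∑ m₂ ∈ Icc 1 N₂, F m₁ m₂ =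
        ∑ m₂ ∈ (Icc 1 N₂).filter (fun m₂ : ℕ ↦ m₁ ≤ m₂), F m₁ m₂ +
          ∑ m₂ ∈ (Icc 1 N₂).filter (fun m₂ : ℕ ↦ m₂ < m₁), F m₁ m₂ := by
      intro m₁ _
      rw [← Finset.sum_filter_add_sum_filter_not (Icc 1 N₂) (fun m₂ : ℕ ↦ m₁ ≤ m₂)]
      congr 1
      refine Finset.sum_congr ?_ fun _ _ ↦ rfl
      ext m₂
      simp only [Finset.mem_filter, not_le]
    rw [Finset.sum_congr rfl h1, Finset.sum_add_distrib]
    congr 1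
    rw [Finset.sum_comm' (t' := Icc 1 N₂) (s' := fun m₂ ↦ (Icc 1 N₁).filter (fun m₁ : ℕ ↦ m₂ < m₁))]
    intro m₁ m₂
    simp only [Finset.mem_filter]
    tauto
  -- region A: outer m₁, inner m₂ ∈ (m₁ − 1, N₂]
  have hA : ∀ m₁ ∈ Icc 1 N₁, ∑ m₂ ∈ (Icc 1 N₂).filter (fun m₂ : ℕ ↦ m₁ ≤ m₂), F m₁ m₂ =
      (w₁ m₁ * logWeight M₁ m₁) *
        ∑ m₂ ∈ Ioc (m₁ - 1) N₂, w₂ m₂ * (logWeight M₂ m₂ * h ((m₁ : ℝ) / Y * m₂)) := by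
    intro m₁ hm₁
    rw [filter_le_eq_Ioc (Finset.mem_Icc.1 hm₁).1, Finset.mul_sum]
    refine Finset.sum_congr rfl fun m₂ _ ↦ ?_
    simp only [hF, show (m₁ : ℝ) * m₂ / Y = (m₁ : ℝ) / Y * m₂ by ring]
    ring
  -- region B: outer m₂, inner m₁ ∈ (m₂, N₁]
  have hB : ∀ m₂ ∈ Icc 1 N₂, ∑ m₁ ∈ (Icc 1 N₁).filter (fun m₁ : ℕ ↦ m₂ < m₁), F m₁ m₂ =
      (w₂ m₂ * logWeight M₂ m₂) *
        ∑ m₁ ∈ Ioc m₂ N₁, w₁ m₁ * (logWeight M₁ m₁ * h ((m₂ : ℝ) / Y * m₁)) := by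
    intro m₂ _
    rw [filter_lt_eq_Ioc, Finset.mul_sum]
    refine Finset.sum_congr rfl fun m₁ _ ↦ ?_
    simp only [hF, show (m₁ : ℝ) * m₂ / Y = (m₂ : ℝ) / Y * m₁ by ring]
    ring
  have hregA := abs_sum_region_le (v := fun n ↦ w₁ n * logWeight M₁ n) (w := w₂)
    (fun n hn ↦ abs_mul_logWeight_le_inv hw₁ hM₁ hn) ha hab hK hLip hsupp hBh hM₂ hY hη hA₂ N₁
    (fun n ↦ n - 1) (fun n _ ↦ by omega) (fun n _ ↦ le_rfl)
  have hregB := abs_sum_region_le (v := fun n ↦ w₂ n * logWeight M₂ n) (w := w₁)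
    (fun n hn ↦ abs_mul_logWeight_le_inv hw₂ hM₂ hn) ha hab hK hLip hsupp hBh hM₁ hY hη hA₁ N₂
    (fun n ↦ n) (fun n _ ↦ by omega) (fun n _ ↦ by omega)
  rw [hsplit, Finset.sum_congr rfl hA, Finset.sum_congr rfl hB]
  refine (abs_add_le _ _).trans ?_
  have := add_le_add hregA hregB
  refine this.trans (le_of_eq ?_)
  ring

end Summit.Parity.GeneralizedHardyLittlewood.Theorems.BeyondDiagonalBeatsQuarter.MellinBump
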